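import Summits.Ventures.GridStability.Lyapunov.K2ALossySplitLinesLPCert
import Summits.Ventures.GridStability.Models.ClassicalSwingGlobal
import HarnessLib

/-!
# «G2.c-K2A-SPLITU» — the positivity certificate's REGION on ★ #22's lossy two-area model at `2·arctan(7/200)`
# (≈ 4.009°): rank-one level, ROA sentence, synchronisation, well-posedness, certified inner ball (file 2 of 2)

Cell `gridfusion` (LADDER-GRIDFUSION G2.c lossy Lur'e tier, Kundur-two-area rung); seat gridfusion-lit-6 (g10).  File 1
(`Lyapunov/K2ALossySplitLinesLPCert.lean`) typed `lpCert : LPSlabCertificate Kundur2A.splitLurieLinesSystem` and its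
sector hypothesis `hsecL`.  HERE (the ★ #146 recipe on the second system):

* `rankOneL` — rank-one facts `s_k·(P + Cᵀdiag(λa)C) − C_kᵀC_k ⪰ 0` against the LOWER MATRIX for all 32 channels
  (`s_k` dyadic `2⁻²⁰`, `≥ C_k L⁻¹ C_kᵀ` rounded up; `2⁻²⁰` on the 20 null channels), 32 kernel `LDLᵀ` on the
  formula (`rankOneL_ldl`), cast through file 1's `C_eq` and `lowerMatrix_eq`;
* the level `c_rk = 407004404237/1000000000000000` (≈ 4.070e-04) with `c_rk·s_k ≤ γ_lo²` on every channel, `γ_lo = 2800/40049 ≤ 2·arctan(7/200)`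
  (`gloLQ_lt_gamma` by the tree's arctan bounds), hence lit-6's level hypothesis `hlevL`;
* **`lossy_splitLinesLP_slab_roa`** — for MODEL M = `Kundur2A.csgPre.toModelRel (1/10) 0`: every solution on `ℝ`
  whose initial Lur'e state lies in the open slab `γ = 2·arctan(7/200)` (every machine-angle-difference deviation
  `|(δ_p − δ_q) − (θ*_p − θ*_q)| < γ`, `mem_slab_iff`) with `V_LP ≤ lev ≤ c_rk` keeps both for all `t ≥ 0` and its
  Lur'e state tends to `0` (lit-6 `LPSlabCertificate.well_subset_regionOfAttraction_of_rankOne` + the hypothesis-free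
  bridge `Kundur2A.hasDerivWithinAt_lurieState_lines`); `_sync` (machine coordinates), `_wellPosed` (∃! solution from
  every admissible state, by model-1's `ClassicalSwing.exists_isSolutionOn_univ` / `isSolutionOn_univ_unique`);
* the CERTIFIED INNER BALL: `t·1 − (P + Cᵀdiag(λb)C) ⪰ 0` with `t = 563/1024` (`upperL_ldl`), `ϱ = 740270887989/1000000000000000`
  (`t·ϱ ≤ c_rk`, `2ϱ ≤ γ_lo²`; `ball_tests`), `|C_k|² ≤ 2` ⇒ `{x : xᵀx ≤ ϱ} ⊆ lpCert.well γ c_rk`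
  (`ball_subset_wellL`, lit-6 `LPSlabCertificate.ball_subset_well`) and `lossy_splitLinesLP_ball_roa`: certified
  Lur'e-state radius `√ϱ ≈ 0.0272` (three line-angle deviations + four speeds, Lur'e units).

THREE COLUMNS.  CERTIFIED for MODEL M, CLASS = the well `{slab 2·arctan(7/200), V_LP ≤ lev}` ∪ the ball — an INNER
estimate of the region of attraction of the synchronous equilibrium OF THE MODEL, a priori over all solutions; the
window `4.009°` is a certificate-class datum (VALIDATED bracket: both split classes feasible at `7/200`, infeasible
from `3/80` ≈ 4.295°, kit j292611/j292644), not a stability margin of any grid.  MODELLED: ★ #22's tokens (Kron-reduced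
WITH constant-impedance loads, transfer conductances KEPT, K rounded h12, scaled time / unit inertias, ASSUMED uniform
damping `λ = 1/10`, `a′ = 0`).  VALIDATED: producer lineage (file 1).  Nothing here says the two-area system or a grid
is stable.
[cite: Pai1981, §2.16 Theorem [18] eqs. (2.63)–(2.64), §3.6.3 eqs. (3.43)–(3.45); Khalil2002, §7.1.2 Theorem 7.3, §4.8 Theorem 4.10; VuTuritsyn2017, §4.3 Theorem 1]
-/

noncomputable section

open Real Set Filter Topology Matrix
open Literature.Computation.Certificates
open Literature.MathematicalPhysics.PowerSystems
open Literature.MathematicalPhysics.PowerSystems.LyapunovFunctionFamily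
open Summit.Ventures.GridStability.Models
open Summit.Ventures.GridStability.Lyapunov.K2ALossySplitLines (e1 eκ AQ CQ BLQ A_eq C_eq)
open Summit.Ventures.GridStability.Lyapunov.K2ALossySplitLinesLPCert (PL lamL aL bL lpCert lpCert_a_b hsecL)

namespace Summit.Ventures.GridStability.Bench.K2ALossySplitLinesLPRoa

/-! ### Rank-one constants, level, lower matrix (literals) -/

/-- Half-tangent of the window: `u = 7/200`. -/
def uLQ : ℚ := 7 / 200

/-- `((uLQ : ℚ) : ℝ) = 7/200`. -/
theorem uLQ_cast : ((uLQ : ℚ) : ℝ) = 7 / 200 := by norm_num [uLQ]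

/-- Inner rational width `γ_lo = 2800/40049` (`≤ sin γ ≤ γ`). -/
def gloLQ : ℚ := 2800/40049

/-- Rank-one constants `s_k` (flattened channel index; dyadic `2⁻²⁰`; `2⁻²⁰` on the null channels). -/
def sLQ : Fin 32 → ℚ :=
  ![1/1048576, 3982211/1048576, 12593125/1048576, 5807177/524288, 3982211/1048576, 1/1048576, 5804521/524288, 10654647/1048576, 12593125/1048576, 5804521/524288, 1/1048576, 3974141/1048576, 5807177/524288, 10654647/1048576, 3974141/1048576, 1/1048576, 1/1048576, 3982211/1048576, 12593125/1048576, 5807177/524288, 3982211/1048576, 1/1048576, 5804521/524288, 10654647/1048576, 12593125/1048576, 5804521/524288, 1/1048576, 3974141/1048576, 5807177/524288, 10654647/1048576, 3974141/1048576, 1/1048576]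

/-- `s` on the typed channel index. -/
def sL (k : ((Fin 4 × Fin 4) ⊕ (Fin 4 × Fin 4))) : ℚ := sLQ (eκ k)

/-- The rank-one level `c_rk = 407004404237/1000000000000000`. -/
def cRkLQ : ℚ := 407004404237/1000000000000000

/-- The lower matrix `P + Cᵀ·diag(λa)·C` over `ℚ` on the typed index (formula, not a literal). -/
def lowerPQ : Matrix (Fin 4 ⊕ Fin 3) (Fin 4 ⊕ Fin 3) ℚ := PL + CQᵀ * Matrix.diagonal (fun k => lamL k * aL k) * CQ

/-- `0 ≤ γ_lo`, `γ_lo²(1 + u²) ≤ 4u²` (i.e. `γ_lo ≤ sin γ`), `0 < u` (kernel arithmetic). -/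
theorem gloL_test : 0 ≤ gloLQ ∧ gloLQ ^ 2 * (1 + uLQ ^ 2) ≤ 4 * uLQ ^ 2 ∧ 0 < uLQ := by
  refine ⟨by norm_num [gloLQ], by norm_num [gloLQ, uLQ], by norm_num [uLQ]⟩

/-- `0 < c_rk`. -/
theorem cRkLQ_pos : 0 < cRkLQ := by norm_num [cRkLQ]

/-- The level tests `0 < s_k` and `c_rk·s_k ≤ γ_lo²` on every channel (kernel). -/
theorem sL_tests : ∀ k, 0 < sLQ k ∧ cRkLQ * sLQ k ≤ gloLQ ^ 2 := by
  decide +kernel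

set_option maxHeartbeats 20000000 in
/-- **The 32 rank-one facts against the lower matrix**, decided in the kernel on the formula (7 × 7 each). -/
theorem rankOneL_ldl : ∀ k : ((Fin 4 × Fin 4) ⊕ (Fin 4 × Fin 4)),
    PSD.LDLCert ((sL k • lowerPQ - Matrix.vecMulVec (CQ k) (CQ k)).submatrix e1.symm e1.symm) := by
  decide +kernel

/-- `γ_lo < 2·arctan(7/200)`: `γ_lo ≤ sin(2·arctan u) = 2u/(1+u²) < 2·arctan u`. -/
theorem gloLQ_lt_gamma : ((gloLQ : ℚ) : ℝ) < 2 * Real.arctan (7 / 200 : ℝ) := by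
  have hsin : Real.sin (2 * Real.arctan (7 / 200 : ℝ)) = ((2800/40049 : ℚ) : ℝ) :=
    Lyapunov.K2ALossySplitLinesLPCert.cos_sin_γL.2
  have hle : ((gloLQ : ℚ) : ℝ) ≤ ((2800/40049 : ℚ) : ℝ) := by norm_num [gloLQ]
  have hpos : 0 < 2 * Real.arctan (7 / 200 : ℝ) := by
    have := Real.arctan_pos.2 (show (0 : ℝ) < 7 / 200 by norm_num)
    linarith
  have hlt : Real.sin (2 * Real.arctan (7 / 200 : ℝ)) < 2 * Real.arctan (7 / 200 : ℝ) := Real.sin_lt hpos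
  linarith

/-! ### Cast plumbing -/

/-- `(M·N) ↦ ℝ` (plumbing). -/
private theorem map_mul' {m n o : Type*} [Fintype n] (M : Matrix m n ℚ) (N : Matrix n o ℚ) :
    (M * N).map (Rat.cast : ℚ → ℝ) = M.map (Rat.cast : ℚ → ℝ) * N.map (Rat.cast : ℚ → ℝ) :=
  Matrix.map_mul (f := Rat.castHom ℝ)
/-- `(M + N) ↦ ℝ` (plumbing). -/
private theorem map_add' {m n : Type*} (M N : Matrix m n ℚ) :
    (M + N).map (Rat.cast : ℚ → ℝ) = M.map (Rat.cast : ℚ → ℝ) + N.map (Rat.cast : ℚ → ℝ) := by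
  ext; simp
/-- `(M − N) ↦ ℝ` (plumbing). -/
private theorem map_sub' {m n : Type*} (M N : Matrix m n ℚ) :
    (M - N).map (Rat.cast : ℚ → ℝ) = M.map (Rat.cast : ℚ → ℝ) - N.map (Rat.cast : ℚ → ℝ) := by
  ext; simp
/-- `Mᵀ ↦ ℝ` (plumbing). -/
private theorem map_transpose' {m n : Type*} (M : Matrix m n ℚ) :
    Mᵀ.map (Rat.cast : ℚ → ℝ) = (M.map (Rat.cast : ℚ → ℝ))ᵀ := by
  ext; simp
/-- `diagonal d ↦ ℝ` (plumbing). -/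
private theorem map_diagonal' {n : Type*} [DecidableEq n] (d : n → ℚ) :
    (Matrix.diagonal d).map (Rat.cast : ℚ → ℝ) = Matrix.diagonal (fun i => ((d i : ℚ) : ℝ)) :=
  Matrix.diagonal_map (Rat.cast_zero)
/-- `(q·M) ↦ ℝ` (plumbing). -/
private theorem map_smul' {m n : Type*} (q : ℚ) (M : Matrix m n ℚ) :
    (q • M).map (Rat.cast : ℚ → ℝ) = (q : ℝ) • M.map (Rat.cast : ℚ → ℝ) := by
  ext; simp
/-- `(v wᵀ) ↦ ℝ` (plumbing). -/
private theorem map_vecMulVec' {m n : Type*} (v : m → ℚ) (w : n → ℚ) :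
    (Matrix.vecMulVec v w).map (Rat.cast : ℚ → ℝ) = Matrix.vecMulVec (fun i => (v i : ℝ)) (fun j => (w j : ℝ)) := by
  ext; simp [Matrix.vecMulVec_apply]
/-- `q • 1 ↦ ℝ` (plumbing). -/
private theorem map_smul_one' {n : Type*} [DecidableEq n] (q : ℚ) :
    (q • (1 : Matrix n n ℚ)).map (Rat.cast : ℚ → ℝ) = ((q : ℚ) : ℝ) • (1 : Matrix n n ℝ) := by
  ext i j; by_cases h : i = j <;> simp [h]

/-- **The certificate's lower matrix is the cast of `lowerPQ`.** -/
theorem lowerMatrix_eq : lpCert.lowerMatrix = lowerPQ.map (Rat.cast : ℚ → ℝ) := by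
  have hd : Matrix.diagonal (fun k => lpCert.lam k * lpCert.a k)
      = (Matrix.diagonal (fun k => lamL k * aL k)).map (Rat.cast : ℚ → ℝ) := by
    rw [map_diagonal']
    congr 1; funext k
    show ((lamL k : ℚ) : ℝ) * ((aL k : ℚ) : ℝ) = _
    push_cast; rfl
  rw [LPSlabCertificate.lowerMatrix, C_eq, hd, lowerPQ]
  show PL.map (Rat.cast : ℚ → ℝ) + _ = _
  simp only [map_add', map_mul', map_transpose']

/-- **Rank-one facts** `s_k·lowerMatrix − C_kᵀC_k ⪰ 0` for every channel, with the dyadic `s_k`.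
[cite: VuTuritsyn2017, §4.3 Theorem 1 (eq. V_min); Khalil2002, §7.1.2 Theorem 7.3] -/
theorem rankOneL (k : ((Fin 4 × Fin 4) ⊕ (Fin 4 × Fin 4))) :
    (((sL k : ℚ) : ℝ) • lpCert.lowerMatrix
      - Matrix.vecMulVec (Kundur2A.splitLurieLinesSystem.C k) (Kundur2A.splitLurieLinesSystem.C k)).PosSemidef := by
  have hC : Kundur2A.splitLurieLinesSystem.C k = fun i => ((CQ k i : ℚ) : ℝ) := by
    rw [C_eq]; rfl
  have h : ((sL k : ℚ) : ℝ) • lpCert.lowerMatrix - Matrix.vecMulVec (Kundur2A.splitLurieLinesSystem.C k) (Kundur2A.splitLurieLinesSystem.C k)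
      = (sL k • lowerPQ - Matrix.vecMulVec (CQ k) (CQ k)).map (Rat.cast : ℚ → ℝ) := by
    rw [hC, lowerMatrix_eq, map_sub', map_smul', map_vecMulVec']
  rw [h]
  have h2 := ((rankOneL_ldl k).posSemidef (R := ℝ)).submatrix e1
  have e : (((sL k • lowerPQ - Matrix.vecMulVec (CQ k) (CQ k)).submatrix ⇑e1.symm ⇑e1.symm).map
      (Rat.cast : ℚ → ℝ)).submatrix e1 e1
      = (sL k • lowerPQ - Matrix.vecMulVec (CQ k) (CQ k)).map (Rat.cast : ℚ → ℝ) := by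
    ext i j; simp
  rwa [e] at h2

/-- `0 < s_k` (real). -/
theorem sL_pos (k : ((Fin 4 × Fin 4) ⊕ (Fin 4 × Fin 4))) : (0 : ℝ) < ((sL k : ℚ) : ℝ) := by
  unfold sL; exact_mod_cast (sL_tests (eκ k)).1

/-- **Level hypothesis**: every `lev ≤ c_rk` satisfies `lev < γ²/s_k` on every channel (`c_rk·s_k ≤ γ_lo² < γ²`). -/
theorem hlevL {lev : ℝ} (hle : lev ≤ ((cRkLQ : ℚ) : ℝ)) (k : ((Fin 4 × Fin 4) ⊕ (Fin 4 × Fin 4))) :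
    lev < (2 * Real.arctan (7 / 200 : ℝ)) ^ 2 / ((sL k : ℚ) : ℝ) := by
  have hs := sL_pos k
  have ht : ((cRkLQ : ℚ) : ℝ) * ((sL k : ℚ) : ℝ) ≤ ((gloLQ : ℚ) : ℝ) ^ 2 := by
    unfold sL; exact_mod_cast (sL_tests (eκ k)).2
  have hg0 : (0 : ℝ) ≤ ((gloLQ : ℚ) : ℝ) := by exact_mod_cast gloL_test.1
  have hg := gloLQ_lt_gamma
  have hsq : ((gloLQ : ℚ) : ℝ) ^ 2 < (2 * Real.arctan (7 / 200 : ℝ)) ^ 2 := by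
    exact pow_lt_pow_left₀ hg hg0 two_ne_zero
  rw [lt_div_iff₀ hs]
  nlinarith

/-! ### The slab in machine coordinates -/

/-- The relative angle coordinates of the Lur'e state, extended by `0` at the reference machine (plumbing). -/
private theorem ext0_lurieState (z : ClassicalSwing.State 4) (p : Fin 4) :
    InternalNode.ext0 ((Kundur2A.csgPre.lurieState Kundur2A.csgPre.angleOf z) ∘ Sum.inr) p = (z.1 p - z.1 0) - (Kundur2A.csgPre.angleOf p - Kundur2A.csgPre.angleOf 0) := by
  rw [RecastData.lurieState_eq]
  cases p using Fin.cases with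
  | zero => simp
  | succ a => simp

/-- **Channel values of the Lur'e state**: channel `inl (p,q)` / `inr (p,q)` reads the machine-angle-difference
deviation `(δ_p − δ_q) − (θ*_p − θ*_q)`. -/
theorem channel_lurieState (z : ClassicalSwing.State 4) (k : ((Fin 4 × Fin 4) ⊕ (Fin 4 × Fin 4))) :
    (Kundur2A.splitLurieLinesSystem.C *ᵥ Kundur2A.csgPre.lurieState Kundur2A.csgPre.angleOf z) k
      = (z.1 (Sum.elim id id k).1 - z.1 (Sum.elim id id k).2)
        - (Kundur2A.csgPre.angleOf (Sum.elim id id k).1 - Kundur2A.csgPre.angleOf (Sum.elim id id k).2) := by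
  rw [show Kundur2A.splitLurieLinesSystem = System.machineReference _ _ _ _ _ from rfl, System.machineReference_C_mulVec,
    InternalNode.fromRows_pairIncidence_mulVec]
  rcases k with k | k
  · rw [Sum.elim_inl, InternalNode.pairIncidence_mulVec, ext0_lurieState, ext0_lurieState]
    simp only [Sum.elim_inl, id]
    ring
  · rw [Sum.elim_inr, InternalNode.pairIncidence_mulVec, ext0_lurieState, ext0_lurieState]
    simp only [Sum.elim_inr, id]
    ring

/-- **The slab in machine-angle terms**: the Lur'e state of `z = (δ, ω)` lies in the open slab `γ` of
`Kundur2A.splitLurieLinesSystem` iff every machine-angle-difference deviation satisfies `|(δ_p − δ_q) − (θ*_p − θ*_q)| < γ`. -/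
theorem mem_slab_iff (z : ClassicalSwing.State 4) (γ : ℝ) :
    Kundur2A.csgPre.lurieState Kundur2A.csgPre.angleOf z ∈ Kundur2A.splitLurieLinesSystem.slab (fun _ => γ) ↔
      ∀ p q : Fin 4, |(z.1 p - z.1 q) - (Kundur2A.csgPre.angleOf p - Kundur2A.csgPre.angleOf q)| < γ := by
  simp only [System.slab, Set.mem_setOf_eq, channel_lurieState]
  constructor
  · intro h p q
    exact h (Sum.inl (p, q))
  · rintro h (⟨p, q⟩ | ⟨p, q⟩) <;> exact h p q

/-! ### THE SENTENCE -/

/-- **«G2.c-K2A-SPLITU» — the certified region of ★ #22's lossy two-area four-machine model at the window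
`2·arctan(7/200)` (≈ 4.009°), Lur'e–Postnikov POSITIVITY certificate on the UNORDERED-LINES split presentation.**
For MODEL M = `Kundur2A.csgPre.toModelRel (1/10) 0` (Chow–Sanchez-Gasca two-area data, Kron-reduced WITH transfer
conductances, h12, unit inertias in scaled time, uniform damping ratio `1/10`, equilibrium `θ* = csgPre.angleOf`):
every solution `c` on `ℝ` whose initial Lur'e state lies in the open slab `γ = 2·arctan(7/200)` (every
`|(δ_p − δ_q) − (θ*_p − θ*_q)| < γ`, `mem_slab_iff`) and has `V_LP ≤ lev` for a level `lev ≤ c_rk = 407004404237/1000000000000000`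
(`V_LP = xᵀPx + 2Σ_k λ_k∫₀^{y_k}F_k` of `lpCert`) keeps BOTH for all `t ≥ 0`, and its Lur'e state tends to `0`.
CERTIFIED for MODEL M, CLASS = the well (inner ROA estimate, a priori over all solutions); MODELLED as ★ #22;
nothing here says the two-area system is stable.
[cite: Pai1981, §2.16 Theorem [18] eqs. (2.63)–(2.64), §3.6.3 eqs. (3.43)–(3.45); Khalil2002, §7.1.2 Theorem 7.3] -/
theorem lossy_splitLinesLP_slab_roa {lev : ℝ} (hle : lev ≤ ((cRkLQ : ℚ) : ℝ))
    {c : ℝ → ClassicalSwing.State 4} (hc : (Kundur2A.csgPre.toModelRel (1 / 10) 0).IsSolutionOn c univ)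
    (h0 : Kundur2A.csgPre.lurieState Kundur2A.csgPre.angleOf (c 0) ∈ Kundur2A.splitLurieLinesSystem.slab (fun _ => 2 * Real.arctan (7 / 200 : ℝ)))
    (h0c : lpCert.V (Kundur2A.csgPre.lurieState Kundur2A.csgPre.angleOf (c 0)) ≤ lev) :
    (∀ t, 0 ≤ t →
        Kundur2A.csgPre.lurieState Kundur2A.csgPre.angleOf (c t) ∈ Kundur2A.splitLurieLinesSystem.slab (fun _ => 2 * Real.arctan (7 / 200 : ℝ)) ∧
          lpCert.V (Kundur2A.csgPre.lurieState Kundur2A.csgPre.angleOf (c t)) ≤ lev) ∧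
      Tendsto (fun t => Kundur2A.csgPre.lurieState Kundur2A.csgPre.angleOf (c t)) atTop (𝓝 0) := by
  have key := lpCert.well_subset_regionOfAttraction_of_rankOne (γ := fun _ => 2 * Real.arctan (7 / 200 : ℝ)) hsecL
    (fun k => sL_pos k) rankOneL (hlevL hle) (y := Kundur2A.csgPre.lurieState Kundur2A.csgPre.angleOf (c 0)) ⟨h0, h0c⟩
  have h2 := key.2 (fun t => Kundur2A.csgPre.lurieState Kundur2A.csgPre.angleOf (c t)) rfl
    fun T t _ => Kundur2A.hasDerivWithinAt_lurieState_lines hc t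
  exact ⟨fun t ht => ⟨(h2.1 t ht).1, (h2.1 t ht).2⟩, h2.2⟩

/-- **The same, read in machine coordinates (synchronisation).** For all `t ≥ 0` every machine-angle-difference
deviation stays `< 2·arctan(7/200)`; every speed deviation `ω_i(t) → 0`; every relative angle
`δ_{a+1}(t) − δ_0(t) → θ*_{a+1} − θ*_0`.  MODELLED as ★ #22; nothing here says the two-area system is stable.
[cite: Pai1981, §3.6.3 eqs. (3.43)–(3.45); Khalil2002, §7.1.2 Theorem 7.3] -/
theorem lossy_splitLinesLP_slab_sync {lev : ℝ} (hle : lev ≤ ((cRkLQ : ℚ) : ℝ))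
    {c : ℝ → ClassicalSwing.State 4} (hc : (Kundur2A.csgPre.toModelRel (1 / 10) 0).IsSolutionOn c univ)
    (h0 : ∀ p q : Fin 4, |((c 0).1 p - (c 0).1 q) - (Kundur2A.csgPre.angleOf p - Kundur2A.csgPre.angleOf q)| < 2 * Real.arctan (7 / 200 : ℝ))
    (h0c : lpCert.V (Kundur2A.csgPre.lurieState Kundur2A.csgPre.angleOf (c 0)) ≤ lev) :
    (∀ t, 0 ≤ t → ∀ p q : Fin 4,
        |((c t).1 p - (c t).1 q) - (Kundur2A.csgPre.angleOf p - Kundur2A.csgPre.angleOf q)| < 2 * Real.arctan (7 / 200 : ℝ)) ∧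
      (∀ i : Fin 4, Tendsto (fun t => (c t).2 i) atTop (𝓝 0)) ∧
      ∀ a : Fin 3, Tendsto (fun t => (c t).1 a.succ - (c t).1 0) atTop (𝓝 (Kundur2A.csgPre.angleOf a.succ - Kundur2A.csgPre.angleOf 0)) := by
  obtain ⟨hkeep, hlim⟩ := lossy_splitLinesLP_slab_roa hle hc ((mem_slab_iff _ _).2 h0) h0c
  have hcoord := tendsto_pi_nhds.1 hlim
  refine ⟨fun t ht => (mem_slab_iff _ _).1 (hkeep t ht).1, fun i => ?_, fun a => ?_⟩
  · have h := hcoord (Sum.inl i)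
    simp only [RecastData.lurieState_eq, Sum.elim_inl, Pi.zero_apply] at h
    exact h
  · have h := hcoord (Sum.inr a)
    simp only [RecastData.lurieState_eq, Sum.elim_inr, Pi.zero_apply] at h
    have h2 := h.add_const (Kundur2A.csgPre.angleOf a.succ - Kundur2A.csgPre.angleOf 0)
    simp only [zero_add, sub_add_cancel] at h2
    exact h2

/-- **Well-posed form**: for every machine state `z` with all `|(δ_p − δ_q) − (θ*_p − θ*_q)| < 2·arctan(7/200)` and
`V_LP(z) ≤ lev ≤ c_rk`: a solution of M on `ℝ` from `z` EXISTS, every solution from `z` is that one, and along it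
the deviations stay in the window with `V_LP ≤ lev`, every `ω_i(t) → 0` and every relative angle converges to its
equilibrium value.  MODELLED as ★ #22. [cite: Khalil2002, §7.1.2 Theorem 7.3; Pai1981, §3.6.3 eqs. (3.43)–(3.45)] -/
theorem lossy_splitLinesLP_slab_wellPosed {lev : ℝ} (hle : lev ≤ ((cRkLQ : ℚ) : ℝ)) (z : ClassicalSwing.State 4)
    (hz : ∀ p q : Fin 4, |(z.1 p - z.1 q) - (Kundur2A.csgPre.angleOf p - Kundur2A.csgPre.angleOf q)| < 2 * Real.arctan (7 / 200 : ℝ))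
    (hzc : lpCert.V (Kundur2A.csgPre.lurieState Kundur2A.csgPre.angleOf z) ≤ lev) :
    (∃ c : ℝ → ClassicalSwing.State 4, c 0 = z ∧ (Kundur2A.csgPre.toModelRel (1 / 10) 0).IsSolutionOn c univ) ∧
      ∀ c : ℝ → ClassicalSwing.State 4, c 0 = z → (Kundur2A.csgPre.toModelRel (1 / 10) 0).IsSolutionOn c univ →
        (∀ c' : ℝ → ClassicalSwing.State 4, c' 0 = z → (Kundur2A.csgPre.toModelRel (1 / 10) 0).IsSolutionOn c' univ → c' = c) ∧
        (∀ t, 0 ≤ t →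
          (∀ p q : Fin 4, |((c t).1 p - (c t).1 q) - (Kundur2A.csgPre.angleOf p - Kundur2A.csgPre.angleOf q)| < 2 * Real.arctan (7 / 200 : ℝ)) ∧
            lpCert.V (Kundur2A.csgPre.lurieState Kundur2A.csgPre.angleOf (c t)) ≤ lev) ∧
        (∀ i : Fin 4, Tendsto (fun t => (c t).2 i) atTop (𝓝 0)) ∧
        ∀ a : Fin 3, Tendsto (fun t => (c t).1 a.succ - (c t).1 0) atTop (𝓝 (Kundur2A.csgPre.angleOf a.succ - Kundur2A.csgPre.angleOf 0)) := by
  refine ⟨(Kundur2A.csgPre.toModelRel (1 / 10) 0).exists_isSolutionOn_univ z, fun c hc0 hc => ?_⟩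
  have hkeep := lossy_splitLinesLP_slab_roa hle hc ((mem_slab_iff _ _).2 (hc0.symm ▸ hz)) (hc0.symm ▸ hzc)
  have hsync := lossy_splitLinesLP_slab_sync hle hc (hc0.symm ▸ hz) (hc0.symm ▸ hzc)
  refine ⟨fun c' hc0' hc' => (Kundur2A.csgPre.toModelRel (1 / 10) 0).isSolutionOn_univ_unique hc' hc (hc0'.trans hc0.symm), ?_,
    hsync.2.1, hsync.2.2⟩
  intro t ht
  exact ⟨hsync.1 t ht, (hkeep.1 t ht).2⟩

/-! ### The certified inner ball -/

/-- Upper constant `t = 563/1024`: `t·1 − (P + Cᵀdiag(λb)C) ⪰ 0`. -/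
def tUQ : ℚ := 563 / 1024

/-- Squared ball radius `ϱ = 740270887989/1000000000000000` (`≈ 7.403e-04`; radius ≈ 0.0272). -/
def rho2LQ : ℚ := 740270887989 / 1000000000000000

/-- The upper matrix `P + Cᵀ·diag(λb)·C` over `ℚ` on the typed index (formula). -/
def upperPQ : Matrix (Fin 4 ⊕ Fin 3) (Fin 4 ⊕ Fin 3) ℚ := PL + CQᵀ * Matrix.diagonal (fun k => lamL k * bL k) * CQ

set_option maxHeartbeats 4000000 in
/-- **`t·1 − (P + Cᵀdiag(λb)C) ⪰ 0`** (7 × 7, kernel `LDLᵀ` on the formula). -/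
theorem upperL_ldl :
    PSD.LDLCert ((tUQ • (1 : Matrix (Fin 4 ⊕ Fin 3) (Fin 4 ⊕ Fin 3) ℚ) - upperPQ).submatrix e1.symm e1.symm) := by
  decide +kernel

/-- Ball tests: `0 ≤ t`, `t·ϱ ≤ c_rk`, `2ϱ ≤ γ_lo²`, `0 < ϱ`. -/
theorem ball_tests : 0 ≤ tUQ ∧ tUQ * rho2LQ ≤ cRkLQ ∧ 2 * rho2LQ ≤ gloLQ ^ 2 ∧ 0 < rho2LQ := by
  refine ⟨by norm_num [tUQ], by norm_num [tUQ, rho2LQ, cRkLQ], by norm_num [rho2LQ, gloLQ], by norm_num [rho2LQ]⟩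

/-- `|C_k|² ≤ 2` for every channel (each row of `C` has at most two entries `±1`; kernel). -/
theorem CQ_sq_le_two : ∀ k : ((Fin 4 × Fin 4) ⊕ (Fin 4 × Fin 4)), CQ k ⬝ᵥ CQ k ≤ 2 := by
  decide +kernel

/-- **The certificate's upper matrix is the cast of `upperPQ`.** -/
theorem upperMatrix_eq : lpCert.upperMatrix = upperPQ.map (Rat.cast : ℚ → ℝ) := by
  have hd : Matrix.diagonal (fun k => lpCert.lam k * lpCert.b k)
      = (Matrix.diagonal (fun k => lamL k * bL k)).map (Rat.cast : ℚ → ℝ) := by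
    rw [map_diagonal']
    congr 1; funext k
    show ((lamL k : ℚ) : ℝ) * ((bL k : ℚ) : ℝ) = _
    push_cast; rfl
  rw [LPSlabCertificate.upperMatrix, C_eq, hd, upperPQ]
  show PL.map (Rat.cast : ℚ → ℝ) + _ = _
  simp only [map_add', map_mul', map_transpose']

/-- `t·1 − upperMatrix ⪰ 0` over `ℝ`. -/
theorem upper_psd : (((tUQ : ℚ) : ℝ) • (1 : Matrix (Fin 4 ⊕ Fin 3) (Fin 4 ⊕ Fin 3) ℝ) - lpCert.upperMatrix).PosSemidef := by
  have h := (upperL_ldl.posSemidef (R := ℝ)).submatrix e1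
  have e : (((tUQ • (1 : Matrix (Fin 4 ⊕ Fin 3) (Fin 4 ⊕ Fin 3) ℚ) - upperPQ).submatrix ⇑e1.symm ⇑e1.symm).map
      (Rat.cast : ℚ → ℝ)).submatrix e1 e1
      = ((tUQ : ℚ) : ℝ) • (1 : Matrix (Fin 4 ⊕ Fin 3) (Fin 4 ⊕ Fin 3) ℝ) - lpCert.upperMatrix := by
    rw [upperMatrix_eq]
    ext i j; by_cases hij : i = j <;> simp [hij]
  rwa [e] at h

/-- **The Euclidean ball `{x : xᵀx ≤ ϱ}` (Lur'e coordinates) lies inside the certified well at `2·arctan(7/200)`,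
level `c_rk`.** [cite: Khalil2002, §4.8 Theorem 4.10 (eq. (4.25)); Pai1981, §2.16 Theorem [18]] -/
theorem ball_subset_wellL :
    {x : (Fin 4 ⊕ Fin 3) → ℝ | x ⬝ᵥ x ≤ ((rho2LQ : ℚ) : ℝ)}
      ⊆ lpCert.well (fun _ => 2 * Real.arctan (7 / 200 : ℝ)) ((cRkLQ : ℚ) : ℝ) := by
  have hγ : (0 : ℝ) < 2 * Real.arctan (7 / 200 : ℝ) := by
    have := Real.arctan_pos.mpr (show (0 : ℝ) < 7 / 200 by norm_num)
    linarith
  refine lpCert.ball_subset_well (γ := fun _ => 2 * Real.arctan (7 / 200 : ℝ)) (fun _ => hγ)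
    (by exact_mod_cast ball_tests.1) upper_psd hsecL (by exact_mod_cast ball_tests.2.1) fun k => ?_
  have hC : Kundur2A.splitLurieLinesSystem.C k = fun i => ((CQ k i : ℚ) : ℝ) := by
    rw [C_eq]; rfl
  have h1 : Kundur2A.splitLurieLinesSystem.C k ⬝ᵥ Kundur2A.splitLurieLinesSystem.C k = ((CQ k ⬝ᵥ CQ k : ℚ) : ℝ) := by
    rw [hC]; simp [dotProduct]
  have h2 : ((CQ k ⬝ᵥ CQ k : ℚ) : ℝ) ≤ 2 := by exact_mod_cast CQ_sq_le_two k
  have h3 : (2 : ℝ) * ((rho2LQ : ℚ) : ℝ) ≤ ((gloLQ : ℚ) : ℝ) ^ 2 := by exact_mod_cast ball_tests.2.2.1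
  have h4 : ((gloLQ : ℚ) : ℝ) ^ 2 < (2 * Real.arctan (7 / 200 : ℝ)) ^ 2 :=
    pow_lt_pow_left₀ gloLQ_lt_gamma (by exact_mod_cast gloL_test.1) two_ne_zero
  have h5 : (0 : ℝ) < ((rho2LQ : ℚ) : ℝ) := by exact_mod_cast ball_tests.2.2.2
  rw [h1]
  nlinarith

/-- **Every solution of M from the ball `{xᵀx ≤ ϱ}` of Lur'e states stays in the certified well and synchronises.**
MODELLED as ★ #22; an inner estimate for THE MODEL, not a margin of any grid.
[cite: Khalil2002, §4.8 Theorem 4.10, §7.1.2 Theorem 7.3; Pai1981, §3.6.3 eqs. (3.43)–(3.45)] -/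
theorem lossy_splitLinesLP_ball_roa {c : ℝ → ClassicalSwing.State 4} (hc : (Kundur2A.csgPre.toModelRel (1 / 10) 0).IsSolutionOn c univ)
    (h0 : Kundur2A.csgPre.lurieState Kundur2A.csgPre.angleOf (c 0) ⬝ᵥ Kundur2A.csgPre.lurieState Kundur2A.csgPre.angleOf (c 0) ≤ ((rho2LQ : ℚ) : ℝ)) :
    (∀ t, 0 ≤ t →
        Kundur2A.csgPre.lurieState Kundur2A.csgPre.angleOf (c t) ∈ Kundur2A.splitLurieLinesSystem.slab (fun _ => 2 * Real.arctan (7 / 200 : ℝ)) ∧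
          lpCert.V (Kundur2A.csgPre.lurieState Kundur2A.csgPre.angleOf (c t)) ≤ ((cRkLQ : ℚ) : ℝ)) ∧
      Tendsto (fun t => Kundur2A.csgPre.lurieState Kundur2A.csgPre.angleOf (c t)) atTop (𝓝 0) := by
  have hw := ball_subset_wellL h0
  rw [LPSlabCertificate.mem_well_iff] at hw
  exact lossy_splitLinesLP_slab_roa le_rfl hc hw.1 hw.2

end Summit.Ventures.GridStability.Bench.K2ALossySplitLinesLPRoa

end
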